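import Summits.CriticalPhenomena.CardyFormulaZ2.Theorems.CardyBoundaryCoulombGasRectilinearCardyClosureDefs
import Literature.Probability.LatticeModels.PolygonWordExactness
import HarnessLib

/-!
# Stub stub_counting of line excursion-kernel-covariance (crux RectilinearCardy, stmt-CriticalPhenomena-5660):
# the closure density is a count over sets of induced edges

The CLOSURE DENSITY `d_δ(v) = P_{1/2}[{v ↔ rowArc in V_δ} ∖ {rowBeyond v ↔ rowArc in V_δ}]` of a
boundary-row vertex `v` of the closure lattice polygon `V_δ = closureFinset R δ` (third definitions
module of the line, `…RectilinearCardyClosureDefs`) is a COUNT: `2^{-|E|}` times the number of sets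
`ω ⊆ E` of induced edges `E = inducedEdges V'` of the polygon read in `ℤ × ℤ`
(`V' = V_δ.image (x ↦ (x 0, x 1))`, edges coded as `(u, dir)` with `SixVertex.edgeTip`) lying in
the density event re-expressed by `Relation.ReflTransGen` paths of `ω`-edges.

Proof. (1) `P_{1/2}` is carried by lattice configurations `ω ⊆ E(ℤ²)` (Mathlib's
`setBernoulli_ae_subset`), so the event may be replaced by any event agreeing with it there
(`measureReal_congr`). (2) For a lattice configuration, an open path of the subgraph of the open
graph induced on `V_δ` is exactly a path of coded induced edges of `V'` whose bonds
`s(![u.1, u.2], ![tip.1, tip.2])` are open (`mem_openConnIn_iff_rtg`: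
`SimpleGraph.reachable_iff_reflTransGen`, `Relation.ReflTransGen.lift`, and an induction for the
converse), so on lattice configurations the density event is the density predicate of the finite
set of LIVE coded edges `{e ∈ E | bond(e) ∈ ω}` (`mem_densityEvent_iff`; the step relation `r` and
the live set `L` are kept abstract through their defining properties `hr`, `hL`). (3) Probabilities
of events read on finitely many coded bonds are counts (`bondPercolation_real_filter_eq_card`, the
`Finset`-coded twin of `PolygonWord.bondPercolation_real_setOf_eq_card`: the event is the disjoint
union over `A ⊆ E` in the predicate of the cylinders "on `E` exactly the bonds of `A` are open",
each of mass `2^{-|E|}` by `Measure.infinitePi_pi`).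
-/

noncomputable section

open Set Filter Topology MeasureTheory
open scoped ENNReal
open Literature.Probability.RandomPlanarGeometry
open Literature.Probability.Percolation (bondPercolation half openCrossing openConnIn openGraph
  openGraph_adj mem_openCrossing_iff BondConfig)
open Literature.Probability.LatticeModels (Site zdGraph zdGraph_adj_iff)
open Literature.Probability.LatticeModels.CollarLegModel (inducedEdges)
open Literature.Probability.LatticeModels.SixVertex (edgeTip mem_edges_iff)

namespace Summit.CriticalPhenomena.CardyFormulaZ2.Cruxes.RectilinearCardy.ExcursionKernelCovariance

open Classical

/-! ### Reading `ℤ × ℤ` in `Site 2`; coded edges as bonds -/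

/-- `![x 0, x 1] = x`. [folklore] -/
private theorem vec_pair (x : Site 2) : (![x 0, x 1] : Site 2) = x := by
  ext i
  fin_cases i <;> rfl

/-- `(![u.1, u.2] 0, ![u.1, u.2] 1) = u`. [folklore] -/
private theorem pair_vec (u : ℤ × ℤ) : ((![u.1, u.2] : Site 2) 0, (![u.1, u.2] : Site 2) 1) = u := by
  simp

/-- `u ↦ ![u.1, u.2]` is injective. [folklore] -/
private theorem vec_inj {u w : ℤ × ℤ} : (![u.1, u.2] : Site 2) = ![w.1, w.2] ↔ u = w :=
  ⟨fun h => by rw [← pair_vec u, ← pair_vec w, h], fun h => by rw [h]⟩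

/-- `u ∈ V.image (x ↦ (x 0, x 1)) ↔ ![u.1, u.2] ∈ V`. [folklore] -/
private theorem mem_image_pair_iff {V : Finset (Site 2)} {u : ℤ × ℤ} :
    u ∈ V.image (fun x : Site 2 => (x 0, x 1)) ↔ (![u.1, u.2] : Site 2) ∈ V := by
  rw [Finset.mem_image]
  constructor
  · rintro ⟨x, hx, rfl⟩
    simpa only [vec_pair] using hx
  · intro h
    exact ⟨_, h, pair_vec u⟩

/-- The coding of the edge `e = (u, dir)` of `ℤ × ℤ` (`dir = false`: `u → u + (1,0)`, `dir = true`: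
`u → u + (0,1)`, far end `SixVertex.edgeTip e`) by the bond `s(![u.1, u.2], ![tip.1, tip.2])` of
`Site 2` is injective. [folklore] -/
private theorem codedBond_injective :
    Function.Injective (fun e : (ℤ × ℤ) × Bool =>
      s((![e.1.1, e.1.2] : Site 2), (![(edgeTip e).1, (edgeTip e).2] : Site 2))) := by
  rintro ⟨u, b⟩ ⟨v, c⟩ h
  dsimp only at h
  rcases Sym2.eq_iff.1 h with ⟨h1, h2⟩ | ⟨h1, h2⟩
  · have hu : u = v := vec_inj.1 h1
    subst hu
    have h3 : edgeTip (u, b) = edgeTip (u, c) := vec_inj.1 h2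
    revert h3
    cases b <;> cases c <;> simp [edgeTip]
  · have h3 : u = edgeTip (v, c) := vec_inj.1 h1
    have h4 : edgeTip (u, b) = v := vec_inj.1 h2
    revert h3 h4
    cases b <;> cases c <;> simp [edgeTip, Prod.ext_iff] <;> omega

/-- Coded edges are bonds of `ℤ²`. [folklore] -/
private theorem codedBond_mem_edgeSet (e : (ℤ × ℤ) × Bool) :
    s((![e.1.1, e.1.2] : Site 2), (![(edgeTip e).1, (edgeTip e).2] : Site 2)) ∈
      (zdGraph 2).edgeSet := by
  obtain ⟨u, b⟩ := e
  rw [SimpleGraph.mem_edgeSet, zdGraph_adj_iff]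
  cases b
  · refine ⟨0, Or.inl ?_⟩
    ext i
    fin_cases i <;> simp [edgeTip]
  · refine ⟨1, Or.inl ?_⟩
    ext i
    fin_cases i <;> simp [edgeTip]

/-- Membership in the induced edges: both endpoints lie in `W`. [folklore] -/
private theorem mem_inducedEdges_iff' {W : Finset (ℤ × ℤ)} {e : (ℤ × ℤ) × Bool} :
    e ∈ inducedEdges W ↔ e.1 ∈ W ∧ edgeTip e ∈ W := by
  unfold inducedEdges
  rw [Finset.mem_filter, mem_edges_iff]
  exact ⟨fun h => h.2, fun h => ⟨Or.inl h.1, h⟩⟩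

/-- The lattice edge from `c` to `c + eᵢ`, coded in `ℤ × ℤ`. [folklore] -/
private theorem exists_edge_single (i : Fin 2) (c : Site 2) :
    ∃ e : (ℤ × ℤ) × Bool, e.1 = (c 0, c 1) ∧
      edgeTip e = ((c + Pi.single i (1 : ℤ) : Site 2) 0, (c + Pi.single i (1 : ℤ) : Site 2) 1) := by
  fin_cases i
  · exact ⟨((c 0, c 1), false), rfl, by simp [edgeTip]⟩
  · exact ⟨((c 0, c 1), true), rfl, by simp [edgeTip]⟩

/-! ### Open paths in the polygon versus paths of live coded edges

Throughout this section `r` is the step relation of the stub over a finite edge set `L` (property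
`hr`), and `L` is the set of LIVE coded edges of the polygon `V` in the configuration `ω`: induced
edges of `V.image (x ↦ (x 0, x 1))` whose bond is open (property `hL`). -/

section Paths

variable {L : Finset ((ℤ × ℤ) × Bool)} {r : ℤ × ℤ → ℤ × ℤ → Prop}
  (hr : ∀ b c : ℤ × ℤ, r b c ↔ ∃ e ∈ L, (e.1 = b ∧ edgeTip e = c) ∨ (e.1 = c ∧ edgeTip e = b))
include hr

/-- The step relation is symmetric. [folklore] -/
private theorem r_symm {b c : ℤ × ℤ} (h : r b c) : r c b := by
  obtain ⟨e, he, h⟩ := (hr b c).1 h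
  exact (hr c b).2 ⟨e, he, h.symm⟩

/-- Paths of `L`-edges are reversible. [folklore] -/
private theorem rtg_symm {b c : ℤ × ℤ} (h : Relation.ReflTransGen r b c) :
    Relation.ReflTransGen r c b := by
  induction h with
  | refl => exact Relation.ReflTransGen.refl
  | tail _ hcd ih => exact Relation.ReflTransGen.head (r_symm hr hcd) ih

variable {V : Finset (Site 2)} {ω : BondConfig (Site 2)}
  (hL : ∀ e : (ℤ × ℤ) × Bool, e ∈ L ↔
    (e.1 ∈ V.image (fun x : Site 2 => (x 0, x 1)) ∧
        edgeTip e ∈ V.image (fun x : Site 2 => (x 0, x 1))) ∧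
      s((![e.1.1, e.1.2] : Site 2), (![(edgeTip e).1, (edgeTip e).2] : Site 2)) ∈ ω)
include hL

/-- An open bond from `c` to `c + eᵢ`, both in `V`, is a step from `(c 0, c 1)` to `(d 0, d 1)`. [folklore] -/
private theorem r_of_single {c d : Site 2} {i : Fin 2} (hc : c ∈ V) (hd : d ∈ V)
    (hmem : s(c, d) ∈ ω) (hi : d = c + Pi.single i 1) : r (c 0, c 1) (d 0, d 1) := by
  subst hi
  obtain ⟨e, he1, he2⟩ := exists_edge_single i c
  refine (hr _ _).2 ⟨e, (hL e).2 ⟨?_, ?_⟩, Or.inl ⟨he1, he2⟩⟩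
  · rw [he1, he2]
    exact ⟨Finset.mem_image_of_mem (fun x : Site 2 => (x 0, x 1)) hc,
      Finset.mem_image_of_mem (fun x : Site 2 => (x 0, x 1)) hd⟩
  · rw [he1, he2]
    simpa only [vec_pair] using hmem

/-- One open bond of a lattice configuration inside `V` is one step. [folklore] -/
private theorem r_of_adj (hω : ω ⊆ (zdGraph 2).edgeSet) {c d : Site 2} (hc : c ∈ V) (hd : d ∈ V)
    (h : (openGraph ω).Adj c d) : r (c 0, c 1) (d 0, d 1) := by
  rw [openGraph_adj] at h
  have hadj : (zdGraph 2).Adj c d := (SimpleGraph.mem_edgeSet (zdGraph 2)).1 (hω h.1)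
  obtain ⟨i, hi | hi⟩ := (zdGraph_adj_iff c d).1 hadj
  · exact r_of_single hr hL hc hd h.1 hi
  · have hmem : s(d, c) ∈ ω := by
      rw [Sym2.eq_swap]
      exact h.1
    exact r_symm hr (r_of_single hr hL hd hc hmem hi)

/-- An open path of the polygon read as a path of live coded edges. [folklore] -/
private theorem rtg_of_reachable (hω : ω ⊆ (zdGraph 2).edgeSet) {a b : ↥(↑V : Set (Site 2))}
    (h : ((openGraph ω).induce (↑V : Set (Site 2))).Reachable a b) :
    Relation.ReflTransGen r ((a : Site 2) 0, (a : Site 2) 1) ((b : Site 2) 0, (b : Site 2) 1) := by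
  rw [SimpleGraph.reachable_iff_reflTransGen] at h
  exact Relation.ReflTransGen.lift (p := r)
    (fun c : ↥(↑V : Set (Site 2)) => ((c : Site 2) 0, (c : Site 2) 1))
    (fun c d hcd => r_of_adj hr hL hω (Finset.mem_coe.1 c.2) (Finset.mem_coe.1 d.2)
      (SimpleGraph.induce_adj.1 hcd)) a b h

/-- A path of live coded edges from a polygon vertex is an open path of the polygon. [folklore] -/
private theorem openConnIn_of_rtg (hω : ω ⊆ (zdGraph 2).edgeSet) {b c : ℤ × ℤ}
    (h : Relation.ReflTransGen r b c) (hb : (![b.1, b.2] : Site 2) ∈ V) :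
    ω ∈ openConnIn (↑V : Set (Site 2)) (![b.1, b.2] : Site 2) (![c.1, c.2] : Site 2) := by
  induction h with
  | refl => exact ⟨Finset.mem_coe.2 hb, Finset.mem_coe.2 hb, SimpleGraph.Reachable.refl _⟩
  | @tail p q _ hpq ih =>
    obtain ⟨hbV, hpV, hreach⟩ := ih
    obtain ⟨e, he, hor⟩ := (hr p q).1 hpq
    obtain ⟨hends, heω⟩ := (hL e).1 he
    have hqV : (![q.1, q.2] : Site 2) ∈ V := by
      rcases hor with ⟨-, h2⟩ | ⟨h1, -⟩
      · rw [← h2]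
        exact mem_image_pair_iff.1 hends.2
      · rw [← h1]
        exact mem_image_pair_iff.1 hends.1
    have hmem : s((![p.1, p.2] : Site 2), (![q.1, q.2] : Site 2)) ∈ ω := by
      rcases hor with ⟨h1, h2⟩ | ⟨h1, h2⟩
      · rw [← h1, ← h2]
        exact heω
      · rw [← h1, ← h2, Sym2.eq_swap]
        exact heω
    have hne : (![p.1, p.2] : Site 2) ≠ ![q.1, q.2] :=
      ((SimpleGraph.mem_edgeSet (zdGraph 2)).1 (hω hmem)).ne
    have hadj : ((openGraph ω).induce (↑V : Set (Site 2))).Adj ⟨![p.1, p.2], hpV⟩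
        ⟨![q.1, q.2], Finset.mem_coe.2 hqV⟩ :=
      SimpleGraph.induce_adj.2 ((openGraph_adj ω _ _).2 ⟨hmem, hne⟩)
    exact ⟨hbV, Finset.mem_coe.2 hqV, hreach.trans hadj.reachable⟩

/-- **Open paths of the polygon are paths of live coded edges.** For a lattice configuration
`ω ⊆ E(ℤ²)` and `x ∈ V`: `{x ↔ y in V}` holds iff `(x 0, x 1)` and `(y 0, y 1)` are joined by a
path of live coded edges. [folklore] -/
private theorem mem_openConnIn_iff_rtg (hω : ω ⊆ (zdGraph 2).edgeSet) {x y : Site 2} (hx : x ∈ V) :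
    ω ∈ openConnIn (↑V : Set (Site 2)) x y ↔ Relation.ReflTransGen r (x 0, x 1) (y 0, y 1) := by
  constructor
  · rintro ⟨_, _, h⟩
    exact rtg_of_reachable hr hL hω h
  · intro h
    have h' := openConnIn_of_rtg hr hL hω h (by simpa only [vec_pair] using hx)
    simpa only [vec_pair] using h'

/-- **On lattice configurations the density event `{v ↔ rowArc} ∖ {rowBeyond v ↔ rowArc}` of the
closure polygon is the density predicate of the live coded edges.** [folklore] -/
private theorem mem_densityEvent_iff (hω : ω ⊆ (zdGraph 2).edgeSet) (R : ConformalRectangle)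
    (δ : ℝ) (hV : closureFinset R δ = V) (v : Site 2) :
    ω ∈ (openCrossing (↑V : Set (Site 2)) ↑(rowArc R δ) {v} \
        openCrossing (↑V : Set (Site 2)) ↑(rowArc R δ) ↑(rowBeyond R δ v)) ↔
      (∃ x ∈ rowArc R δ, Relation.ReflTransGen r (v 0, v 1) (x 0, x 1)) ∧
        ¬ (∃ y ∈ rowBeyond R δ v, ∃ x ∈ rowArc R δ,
            Relation.ReflTransGen r (y 0, y 1) (x 0, x 1)) := by
  have hA : ∀ {x : Site 2}, x ∈ rowArc R δ → x ∈ V := fun hx =>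
    hV ▸ boundaryRow_subset R δ (rowArc_subset R δ hx)
  rw [Set.mem_sdiff, mem_openCrossing_iff, mem_openCrossing_iff]
  constructor
  · rintro ⟨⟨x, hx, y, hy, hxy⟩, hnot⟩
    rw [Set.mem_singleton_iff] at hy
    subst hy
    refine ⟨⟨x, hx, rtg_symm hr ((mem_openConnIn_iff_rtg hr hL hω (hA hx)).1 hxy)⟩, ?_⟩
    rintro ⟨y', hy', x', hx', h⟩
    exact hnot ⟨x', hx', y', hy', (mem_openConnIn_iff_rtg hr hL hω (hA hx')).2 (rtg_symm hr h)⟩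
  · rintro ⟨⟨x, hx, h⟩, hnot⟩
    refine ⟨⟨x, hx, v, Set.mem_singleton v,
      (mem_openConnIn_iff_rtg hr hL hω (hA hx)).2 (rtg_symm hr h)⟩, ?_⟩
    rintro ⟨x', hx', y', hy', h'⟩
    exact hnot ⟨y', hy', x', hx', rtg_symm hr ((mem_openConnIn_iff_rtg hr hL hω (hA hx')).1 h')⟩

end Paths

/-! ### Probabilities of events read on finitely many coded bonds are counts -/

/-- Coded cylinder events are measurable. [folklore] -/
private theorem measurableSet_codedCyl {α : Type*} (φ : α → Sym2 (Site 2)) (E A : Finset α) :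
    MeasurableSet {ω : BondConfig (Site 2) | ∀ e ∈ E, φ e ∈ ω ↔ e ∈ A} := by
  have h : {ω : BondConfig (Site 2) | ∀ e ∈ E, φ e ∈ ω ↔ e ∈ A} =
      ⋂ e ∈ E, {ω | φ e ∈ ω ↔ e ∈ A} := by
    ext ω
    simp
  rw [h]
  exact Finset.measurableSet_biInter E fun e _ =>
    measurableSet_setOf.2 ((measurable_set_mem _).iff measurable_const)

open ProbabilityTheory in
/-- **The Bernoulli(1/2) marginal on coded bonds**: the cylinder "on `E` exactly the bonds of `A`
are open" has probability `2^{-|E|}` (`setBernoulli_apply'`, `Measure.infinitePi_pi`, one factor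
`1/2` per bond — `PolygonWord.bernoulliHalf_factor`). [folklore] -/
private theorem bondPercolation_codedCyl {α : Type*} (φ : α → Sym2 (Site 2))
    (hφ : Function.Injective φ) (E A : Finset α) (hE : ∀ e ∈ E, φ e ∈ (zdGraph 2).edgeSet) :
    bondPercolation (zdGraph 2) half {ω | ∀ e ∈ E, φ e ∈ ω ↔ e ∈ A} = (2⁻¹ : ℝ≥0∞) ^ E.card := by
  rw [Literature.Probability.Percolation.bondPercolation, setBernoulli_apply']
  have hpre : (fun p : Sym2 (Site 2) → Prop => {i | p i}) ⁻¹'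
        {ω : BondConfig (Site 2) | ∀ e ∈ E, φ e ∈ ω ↔ e ∈ A} =
      Set.pi (↑(E.image φ)) (fun s => {q : Prop | q ↔ s ∈ A.image φ}) := by
    ext p
    simp only [Set.mem_preimage, Set.mem_setOf_eq, Set.mem_pi, Finset.coe_image,
      Set.forall_mem_image, Finset.mem_coe]
    refine forall₂_congr fun l _ => ?_
    rw [hφ.mem_finset_image]
  rw [hpre, Measure.infinitePi_pi _ (fun _ _ => MeasurableSpace.measurableSet_top),
    Finset.prod_image (fun l _ l' _ h => hφ h)]
  rw [Finset.prod_congr rfl (fun l hl =>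
      Literature.Probability.LatticeModels.PolygonWord.bernoulliHalf_factor (hE l hl) _),
    Finset.prod_const]

/-- The same in real numbers: `P(cylinder) = (2 ^ |E|)⁻¹`. [folklore] -/
private theorem bondPercolation_real_codedCyl {α : Type*} (φ : α → Sym2 (Site 2))
    (hφ : Function.Injective φ) (E A : Finset α) (hE : ∀ e ∈ E, φ e ∈ (zdGraph 2).edgeSet) :
    (bondPercolation (zdGraph 2) half).real {ω | ∀ e ∈ E, φ e ∈ ω ↔ e ∈ A} =
      ((2 : ℝ) ^ E.card)⁻¹ := by
  rw [measureReal_def, bondPercolation_codedCyl φ hφ E A hE, ENNReal.toReal_pow, ENNReal.toReal_inv,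
    ENNReal.toReal_ofNat, inv_pow]

/-- **Probabilities of events read on finitely many coded bonds are counts.** If an event only asks
which of the bonds coded by `E` are open, through a predicate `Q` of that finite set, then its
`P_{1/2}`-probability is `2^{-|E|} · #{A ⊆ E | Q A}` (the `Finset`-coded twin of
`PolygonWord.bondPercolation_real_setOf_eq_card`). [folklore] -/
private theorem bondPercolation_real_filter_eq_card {α : Type*} (φ : α → Sym2 (Site 2))
    (hφ : Function.Injective φ) (E : Finset α) (hE : ∀ e ∈ E, φ e ∈ (zdGraph 2).edgeSet)
    (Q : Finset α → Prop) {_ : DecidablePred Q} :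
    (bondPercolation (zdGraph 2) half).real {ω | Q (E.filter fun e => φ e ∈ ω)} =
      ((2 : ℝ) ^ E.card)⁻¹ * ((E.powerset.filter Q).card : ℝ) := by
  have hset : {ω : BondConfig (Site 2) | Q (E.filter fun e => φ e ∈ ω)} =
      ⋃ A ∈ E.powerset.filter Q, {ω | ∀ e ∈ E, φ e ∈ ω ↔ e ∈ A} := by
    ext ω
    simp only [Set.mem_setOf_eq, Set.mem_iUnion, Finset.mem_filter, Finset.mem_powerset,
      exists_prop]
    constructor
    · intro hω
      refine ⟨E.filter (fun e => φ e ∈ ω), ⟨Finset.filter_subset _ _, hω⟩, fun e he => ?_⟩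
      rw [Finset.mem_filter]
      exact ⟨fun h => ⟨he, h⟩, fun h => h.2⟩
    · rintro ⟨A, ⟨hA, hQ⟩, hω⟩
      have hEA : E.filter (fun e => φ e ∈ ω) = A := by
        ext e
        rw [Finset.mem_filter]
        exact ⟨fun h => (hω e h.1).1 h.2, fun h => ⟨hA h, (hω e (hA h)).2 h⟩⟩
      rw [hEA]
      exact hQ
  rw [hset, measureReal_biUnion_finset]
  · rw [Finset.sum_congr rfl (fun A _ => bondPercolation_real_codedCyl φ hφ E A hE),
      Finset.sum_const, nsmul_eq_mul, mul_comm]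
  · intro A hA A' hA' hne
    rw [Function.onFun, Set.disjoint_left]
    intro ω h1 h2
    apply hne
    rw [Finset.mem_coe, Finset.mem_filter, Finset.mem_powerset] at hA hA'
    ext l
    constructor
    · intro hl
      exact (h2 l (hA.1 hl)).1 ((h1 l (hA.1 hl)).2 hl)
    · intro hl
      exact (h1 l (hA'.1 hl)).1 ((h2 l (hA'.1 hl)).2 hl)
  · exact fun A _ => measurableSet_codedCyl φ E A

/-! ### The stub -/

open Classical in
/-- **Stub N — COUNTING.** The closure density of a boundary-row vertex `v` is a count: `2^{-|E|}`
times the number of sets `ω ⊆ E` of induced edges of the closure polygon (read in `ℤ × ℤ`) in the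
density event `{v ↔ rowArc} ∖ {rowBeyond v ↔ rowArc}` (paths of `ω`-edges; all their vertices lie
in the polygon because `ω ⊆ E`). Product-measure marginal on the finitely many induced edges
(`bondPercolation_real_setOf_eq_card` pattern, a.s. `ω ⊆ E(ℤ²)`), transcription
`Sym2 (Site 2)`/`(ℤ × ℤ) × Bool` by `edgeSym2`. [folklore] -/
theorem stub_counting :
    ∀ (R : ConformalRectangle) (δ : ℝ) (v : Site 2), 0 < δ → v ∈ boundaryRow R δ →
      closureDensity R δ v =
        ((2 : ℝ) ^ (inducedEdges ((closureFinset R δ).image fun x : Site 2 => (x 0, x 1))).card)⁻¹ *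
          (((inducedEdges ((closureFinset R δ).image fun x : Site 2 => (x 0, x 1))).powerset.filter
              fun ω : Finset ((ℤ × ℤ) × Bool) =>
                (∃ x ∈ rowArc R δ, Relation.ReflTransGen (fun b c : ℤ × ℤ ↦ ∃ e ∈ ω,
                    (e.1 = b ∧ Literature.Probability.LatticeModels.SixVertex.edgeTip e = c) ∨
                      (e.1 = c ∧ Literature.Probability.LatticeModels.SixVertex.edgeTip e = b)) (v 0, v 1) (x 0, x 1)) ∧
                  ¬ (∃ y ∈ rowBeyond R δ v, ∃ x ∈ rowArc R δ,
                      Relation.ReflTransGen (fun b c : ℤ × ℤ ↦ ∃ e ∈ ω,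
                        (e.1 = b ∧ Literature.Probability.LatticeModels.SixVertex.edgeTip e = c) ∨
                          (e.1 = c ∧ Literature.Probability.LatticeModels.SixVertex.edgeTip e = b)) (y 0, y 1) (x 0, x 1))).card : ℝ) := by
  intro R δ v _ _
  unfold closureDensity
  refine (measureReal_congr ?_).trans
    (bondPercolation_real_filter_eq_card
      (fun e : (ℤ × ℤ) × Bool =>
        s((![e.1.1, e.1.2] : Site 2), (![(edgeTip e).1, (edgeTip e).2] : Site 2)))
      codedBond_injective _ (fun e _ => codedBond_mem_edgeSet e) _)
  refine Filter.eventuallyEq_set.2 ?_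
  filter_upwards [(ProbabilityTheory.setBernoulli_ae_subset :
    ∀ᵐ ω ∂(bondPercolation (zdGraph 2) half), ω ⊆ (zdGraph 2).edgeSet)] with ω hω
  exact mem_densityEvent_iff (fun _ _ => Iff.rfl)
    (fun e => by simp only [Finset.mem_filter, mem_inducedEdges_iff']) hω R δ rfl v

end Summit.CriticalPhenomena.CardyFormulaZ2.Cruxes.RectilinearCardy.ExcursionKernelCovariance

end
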